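import Summits.BirchSwinnertonDyer.BirchSwinnertonDyer.Theses.OneSidedTwistSqueezeX9
import Summits.BirchSwinnertonDyer.BirchSwinnertonDyer.Theorems.OneSidedTwistSqueezeX9KatoDivisibilityX9OfGradedEulerLossLattice
import HarnessLib

set_option autoImplicit false
set_option linter.dupNamespace false

/-!
# Disproof of `KatoDivisibilityX9` — B2 width half (`stub_widthX9 : SIM.FineMuConcentratedOnClassX9`) — findings

Seat `refuter-cdisprove-stmt-BirchSwinnertonDyer-20547-g0-0` (crux-disprove, director MINT (207)(7), 2026-08-28).
Target: the width half B2 of the line `graded_euler_loss`, i.e. `FineMuConcentratedOnClassX9`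
(`∀ X9 pair, ∀ fine dual datum Y, ∀ n, μ(pⁿ·X₀) = 0 → μ(X₀) ≤ n`), which by the tree
(`…ResidualWidthX9.forall_mu_le_iff_residualWidth_le_one`) is EXACTLY «`w(X₀) := μ(X₀/pX₀) = rank_Ω(X₀/pX₀) ≤ 1`
at every X9 pair», one storey above Coates–Sujatha Conjecture A («`w(X₀) = 0`»).
**BSD is not proved by any of this; B2, Conjecture A on X9 and the crux stay OPEN.**

## (0) Verdict shape: no kill is reachable, by structure — what the data EXCLUDES instead
* An unconditional `¬ FineMuConcentratedOnClassX9` needs an X9 pair `(E, p)` with `w(X₀(E/ℚ_∞)) ≥ 2`, i.e. a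
  counterexample to Conjecture A over `ℚ(E[p^∞])`-free cyclotomic towers; none is known, and the interface
  `FineSelmerDualData` is pinned (bijection onto the Pontryagin dual of `fineSelmerInfty`), so no junk model exists and
  no instance is constructible in the tree.  `w ≥ 2` is moreover NOT READABLE AT ANY FINITE LAYER: for a torsion
  `Ω`-free part of rank `r` plus blocks `Ω/T^{a_j}`, layer `n` sees only `m_n = r·pⁿ + Σ_j min(a_j, pⁿ)`, which does not
  separate `r ≥ 2` from long blocks.  Hence this file records, per pair, what layer-0 data EXCLUDES.
* Load-bearing hypotheses (mutation pass): dropping any conjunct of `ClassX9` (`¬CM`, `5 ≤ p`, good reduction,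
  `p ∤ a_p`, irreducibility, non-surjectivity), or `κ.IsCyclotomic` (redundant over `ℚ`: the cyclotomic tower is the only
  `ℤ_p`-extension), leaves a statement still implied by Conjecture A, which is hypothesis-free over the cyclotomic
  tower — so no `_false_without_` lemma exists unless Conjecture A itself fails.  Natural module-shell strengthening
  «every f.g. torsion `Λ`-module with `μ(pM) = 0` has `μ(M) ≤ 1`» is FALSE (`M = (Λ/p)²`: `pM = 0`, `μ(M) = 2`) — the
  arithmetic of `X₀` is load-bearing, not the module algebra (not typed here: no `μ(Λ/p) = 1` lemma in the tree yet).

## (1) ENGINE A — layer-0 generator bound, all 848 X9 pairs (Cremona `N < 5·10⁵`; pure exact arithmetic, no CAS)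
For an X9 pair put `Y = X₀ = ` dual fine Selmer group over `ℚ_∞`, `g(Y) := dim_𝔽ₚ Y/(p,T)Y` (minimal number of
`Λ`-generators), so `w(X₀) ≤ g(Y)` and: `g = 0 ⟹ X₀ = 0` (Conj A and `w = 0` at the pair), `g ≤ 1 ⟹ X₀` cyclic `⟹
w ≤ 1` (B2 at the pair; tree: `fineMu_le_of_cyclic`, below `widthHalfAt_of_fineDualCyclicAt`).  CONTROL (inf–res for
`R(E/ℚ_∞)^Γ`, `E(ℚ_∞)[p] = 0` because `im ρ̄` is irreducible of order prime to `p`; `Γ ≅ ℤ_p` has `cd = 1`):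
  `g(Y) = dim R(E/ℚ_∞)^Γ[p] ≤ dim R(E/ℚ)[p] + Σ_{v ∈ {p} ∪ {ℓ ∣ N}} dim H¹(Γ_v, E(ℚ_{∞,w})[p^∞])[p]`, NO finite error term,
with `dim R(E/ℚ)[p] = s_p − rk(Sel_p(E/ℚ) → E(ℚ_p)/(p, tors) ≅ 𝔽_p) ≤ s_p − ε′` and the local terms EXACTLY:
additive `ℓ`: 0 (`E(ℚ_{∞,w})[p] = 0`: formal group pro-`ℓ`, `Ẽ_ns ≅ 𝔾_a`, `#Φ ≤ 4 < p`); nonsplit multiplicative: 0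
(`N_v = (μ_{p^∞} ⊗ χ)^{G} ` is `0` or `p`-divisible with `γ_v − 1` invertible); split multiplicative `I_n`:
`t_ℓ := [p ∣ n = c_ℓ]` (for `ℓ ≡ 1` and `ℓ ≢ 1 (mod p)` alike: `N_v/μ-part ≅ ℤ/p^{v_p(n)}` with trivial `Γ_v`-action);
`v = p` good ordinary: `e_p := dim E(ℚ_p)[p]` (`Ê(ℚ_{∞,w})[p] = 0` since `ωφ̄ ≠ 1`, so `N_p ↪ Ẽ[p^∞]` is cyclic and
`#H¹ = #H⁰`).  Hence **`g(Y) ≤ A := (s_p − ε′) + e_p + t_Σ`**, `t_Σ := #{ℓ ∣ N split mult., p ∣ c_ℓ}`, where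
* `s_p = dim Sel_p(E/ℚ)` OF RECORD (x9-g14 descents, HOME X9-MU-TABLE-v1.1 cols 43–45; grade carried per row:
  EXACT / GRH / GRH(log-derived); rows graded INCOMPLETE/`?`/absent (80) use `s_p := max(rank, record)` = «Ш[p] = 0
  ASSUMED», flagged UNCERTIFIED);
* `e_p = [a_p ≡ 1 (mod p)]` — PROVED on X9, not measured: `p ∤ #im ρ̄` (`#5S4 = 96`; `Ns` = normaliser of the SPLIT Cartan in Sutherland's labels: `#im ∣ 2(p−1)²`, i.e. `∣ 32` at `p = 5`, `∣ 72` at `p = 7`) ⟹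
  `E[p] ≅ Ê[p] ⊕ Ẽ[p]` as `D_p`-modules (Maschke) ⟹ anomalous ⟺ a rational `p`-torsion line in `E(ℚ_p)` (= D25e);
* `ε′ = [∃ Cremona generator P_i with k_i = 1 + e_p]`, `k_i := −v_p(x(m·P_i))/2`, `m := #Ẽ(𝔽_p)` (non-anomalous:
  `φ(P) ≠ 0 ⟺ v_p(x(mP)) = −2`; anomalous, `E(ℚ_p)_{(p)} = E₁ ⊕ ⟨τ⟩`: `mP = p·q₁` and `[p] : E_k → E_{k+1}` shifts the level by
  exactly one for `p ≥ 3`, so `q₁ ∉ E₂ ⟺ v_p(x(mP)) = −4`); only the Mordell–Weil part of `Sel_p` is credited, so `A` is an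
  upper bound (the Ш-part's image under `φ` is not computed);
* `t_Σ` from the minimal model: multiplicative iff `v_ℓ(c₄) = 0`; split iff `(−c₆ | ℓ) = +1` (`ℓ` odd), resp. (ℓ = 2) the
  tangent cone `T² + T + (a₂ + 3x₀)` at the singular point splits.
ARTEFACTS (item evidence on stmt-…-20547): `work/boundA.py` (stdlib python, exact), `B2-WIDTH-TABLE-A-v1.tsv`
(sha16 `a030f8111354c249`, 848 rows × 23 cols, 0.4 s), `B2-WIDTH-summary-A-v1.json`.
CONTROLS (all pass): `a_p` recomputed by point count 848/848; generators on the curve and `#gens = rank` 848/848;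
Tamagawa identity `Σ_{split, p ∣ n_ℓ} v_p(n_ℓ) = v_p(∏ c_ℓ)` (Cremona allbsd) 848/848; D25-CENSUS `k` column = `k_1`
415/415; FMW-CERT-v2 rows ⟹ `A = 0` 234/234; D25 `Y ≠ 0` rows ⟹ `A ≥ 1` 38/38 (`A = 1` exactly at 23104bp1, 46128a1,
171396g1 @5, the three `#Y = 25` rows).

## (2) VERDICTS (layer 0, engine A)
* **`A = 0 ⟹ X₀ = 0`** (Conjecture A and `w = 0` at the pair): **476** pairs (certified `s_p`: 456 = EXACT 82 / GRH 193 /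
  GRH-log 181; uncertified 20);
* **`A = 1 ⟹ X₀` cyclic ⟹ `w(X₀) ≤ 1`** (B2 at the pair): **281** (certified 254 = EXACT 64 / GRH 112 / GRH-log 78;
  uncertified 27);
* **OPEN at layer 0 (`A ≥ 2`; the data cannot exclude `w = 2`)**: **91** (`A = 2`: 80, `A = 3`: 11; certified `s_p` 58,
  uncertified 33).  By cause: 14 rank-0 rows with `s_p = 2` (Ш[p] ≠ 0: 38088v1, 131043s1, 199988e1, 219024bv1/bv2,
  272484k1/k2, 274752br1, 347328cd1, 351424bn1, 374544bm1/bm2, 464648c1 @5, 378225bn1 @7); 33 rank-≥ 2 rows with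
  `e_p + t_Σ ≥ 1` (at 133956a1@5, rank 3, `g(X₀) = 2` is FORCED: `dim R(E/ℚ)[5] ≥ r − 1 = 2` injects — undecidable at
  layer 0 by any engine); 36 rank-1 rows with `ε′ = 0` or `e_p + t_Σ ≥ 2`; 8 rank-0 `s_p = 0` rows with `e_p = t_Σ = 1`.
* The 16 PARTITION-open rows of the cell (-imc R4/R4′): the 6 OPEN-R0 rows (51984e1, 55112a1, 464648b1, 207936hp1,
  232324c1, 254016cb1 @5) have every bad prime additive and are non-anomalous ⟹ all local terms vanish ⟹
  `A = dim Ш(E)[5]` = exactly the uncertified descent datum (engine A adds nothing; engine C below is the `s_p`-free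
  reading); 10368b1, 12996i1 @5 (HELD-A25): **`A = 1`** (`s_p = 1` GRH-log, anomalous `e_p = 1`, `ε′ = 1` at `k = 2`,
  `t = 0`) ⟹ `X₀` cyclic ⟹ `w ≤ 1` (HELD-W1 candidates, COND-GRH-log through `s_p`); the 8 Ш-cells: `A = 2`, undecided.

## (3) ENGINE C (independent, `s_p`-free) — kit j313983+j314455+j313606(partial:818/848,timeout) (pari; GP re-implementation of engine A + class groups; canary j313276)
`g(Y) ≤ C := rank_p Cl^Σ(ℚ(P)) + 2e_p + Σ_{ℓ∣N}(e_ℓ + t_ℓ)`, `ℚ(P)` = field of one `p`-torsion point in the smallest `G_ℚ`-orbit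
(degree 24 for 5S4; 8 for 5Ns and 12 for 7Ns = the axis orbit of the split-Cartan normaliser), `Σ = {p} ∪ {ℓ ∣ N}`,
`e_ℓ = dim E(ℚ_ℓ)[p]` (restriction to `L = ℚ(E[p])` injective as `p ∤ #G`; fine classes of `E[p]` give `Hom_G(Cl^Σ(L)/p, E[p])`;
absolute irreducibility ⟹ `dim = mult ≤ dim (Cl^Σ(L)/p)^{Stab P} = rank_p Cl^Σ(ℚ(P))`, invariants exact and norm argument since
`p ∤ [L:ℚ(P)]`).  `bnfinit` ⟹ GRH-conditional unless the row's `certify` flag is 1 (`bnfcertify` times out on the degree-24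
fields: flag −2).  C computed on 819 rows (0 timeouts, 0 errors); `C < A_E` on 12 rows, `=` on 462,
`>` on 345.  ENGINE A′ (GP) vs ENGINE A (python): `e_p, t_Σ, ε′, s_p, A` agree on 848/848 rows (two methods for `ε′`).

## (4) ENGINES D and E (Poitou–Tate refinement of the control term; exact arithmetic, `engineD.py` / `engineE.py`)
`coker(R(E/ℚ) → R(E/ℚ_∞)^Γ) = (⊕_v K_v) ∩ loc(H¹(G_Σ,T_pE))^⊥`, `K_ℓ ≅ Φ_ℓ ⊗ ℤ_p` (split multiplicative `ℓ`, unramified classes),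
`K_p = Hom(Γ_p, E(ℚ_p)[p])`; so `dim coker[p] ≤ e_p + t_Σ − rank M`, `M` = matrix of local Tate pairings of the generators `P_i` of `E(ℚ)`
against generators `y_v` of the `K_v[p]`: for `ℓ ∈ S_t` the entry is the component `[P_i]_ℓ mod p` (`± min(v_ℓ(2y+a₁x+a₃), c_ℓ/2)`, signs
fixed by additivity; zero-test vs formula 156/156) — ENGINE D, `A_D := (s_p − ε′) + e_p + t_D`, `t_D := t_Σ − rank M_ℓ`; for `v = p`
anomalous the entry is `λ(P_i) = Fq(unit part of f_τ(P_i))` (`f_τ` = normalised Miller function of a generator `τ ∈ E(ℚ_p)[p]`, i.e. the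
Kummer value `b(P,τ)`, AEC X §1; `⟨χ·τ, P⟩ = ±χ(Art_p(f_τ(P)))` vanishes iff `f_τ(P) ∈ p^ℤ μ_{p−1}(1+p²ℤ_p)`; `Fq(w) = (w^{p−1}−1)/p mod p`)
— ENGINE E, `A_E := (s_p − ε′) + (e_p + t_Σ − rank M_full) ≤ A_D ≤ A`.  EXACT when rank ≥ 1 and Ш(E/ℚ)[p^∞] is finite
(`H¹(G_Σ,T_pE) = E(ℚ)⊗ℤ_p`); rank 0: the one compact class is non-Selmer, only `coker ≥ e_p + t_D − 1`.  Self-tests of E on the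
67 anomalous rank ≥ 1 rows: `(p−1)τ = −τ` 67/67, bilinearity 76/76, `λ(pP) = 0` 67/67, non-degeneracy 67/67, linearity in `τ` (`λ_{kτ} = kλ_τ`, k = 2, 3, −1) 201/201, divisor invariance `λ((P+S)−(S)) = λ(P)` (random `p`-adic `S`) 201/201.  D improves A on
115 rows; E improves D on 50 ({'W1:Y-cyclic,width<=1 -> W1:Y-cyclic,width<=1': 14, 'W1:Y-cyclic,width<=1 -> W0:Y=0': 34, 'OPEN:g<=2 -> OPEN:g<=2': 3, 'OPEN:g<=2 -> W1:Y-cyclic,width<=1': 16}).  **133956a1@5 (rank 3): `g = 2` exactly ⟹ X₀ NOT cyclic**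
(`w` still undecided: `Λ/p ⊕ Λ/T` has `g = 2`, `w = 1`).  Literature: this is Wuthrich's fine Mordell–Weil phenomenon made explicit
(Math. Proc. Camb. Phil. Soc. 142 (2007) §7, Thm 7.1/Cor 7.2, the 433A/`p = 3` example; J. Alg. Geom. 16 (2007); Lim arXiv:2006.16447 §3).

## (5) VERDICTS v2 (`g_lo ≤ g ≤ ĝ := min(A_E, C)`; table `B2-WIDTH-TABLE-v2.tsv` sha16 `41bed43a3cec88a0`)
**X₀ = 0 at 572**, **X₀ cyclic ⟹ w ≤ 1 at 259**, OPEN 17 ({'OPEN:g<=2': 16, 'OPEN:g=2 exactly(X0 NOT cyclic)': 1});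
`g` pinned exactly on 722 rows; v1 (A alone) was 476 / 281 / 91.  Rows improved by C: 38088v1@5, 131043s1@5, 199988e1@5, 272484k1@5, 272484k2@5, 274752br1@5, 347328cd1@5, 351424bn1@5, 374544bm1@5, 374544bm2@5, 464648c1@5, 378225bn1@7.
THE 16 PARTITION-OPEN ROWS — readings (one bnf per row serves -imc R1′/R1/R4′ and c38a):
  10368b1@5 [HELD-A25] A=1 A_D=1 A_E=0 (s_p=1 GRH(log-derived); eps=1 e_p=1 t=0) | F_deg=24 rk5Cl(F)=0 rk5ClSigma(F)=0 Cl(F)=6,3 h(F)=18 certify=-2 | C=2 g=0 -> W0:Y=0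
  12996i1@5 [HELD-A25] A=1 A_D=1 A_E=0 (s_p=1 GRH(log-derived); eps=1 e_p=1 t=0) | F_deg=24 rk5Cl(F)=0 rk5ClSigma(F)=0 Cl(F)=6,2 h(F)=12 certify=-2 | C=2 g=0 -> W0:Y=0
  38088v1@5 [Sha-cell] A=2 A_D=2 A_E=- (s_p=2 GRH; eps=0 e_p=0 t=0) | F_deg=24 rk5Cl(F)=1 rk5ClSigma(F)=1 Cl(F)=10,2 h(F)=20 certify=-2 | C=1 g=1 -> W1:Y-cyclic,width<=1
  51984e1@5 [OPEN-R0] A=0 A_D=0 A_E=- (s_p=0 UNCERTIFIED(descent gr; eps=0 e_p=0 t=0) | F_deg=24 rk5Cl(F)=0 rk5ClSigma(F)=0 Cl(F)=12,2,2 h(F)=48 certify=-1 | C=0 g=0 -> W0:Y=0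
  55112a1@5 [OPEN-R0] A=0 A_D=0 A_E=- (s_p=0 UNCERTIFIED(descent gr; eps=0 e_p=0 t=0) | F_deg=24 rk5Cl(F)=0 rk5ClSigma(F)=0 Cl(F)=2 h(F)=2 certify=-1 | C=0 g=0 -> W0:Y=0
  207936hp1@5 [OPEN-R0] A=0 A_D=0 A_E=- (s_p=0 UNCERTIFIED(descent gr; eps=0 e_p=0 t=0) | F_deg=24 rk5Cl(F)=0 rk5ClSigma(F)=0 Cl(F)=12,2,2 h(F)=48 certify=-1 | C=0 g=0 -> W0:Y=0
  219024bv1@5 [Sha-cell] A=2 A_D=2 A_E=- (s_p=2 GRH; eps=0 e_p=0 t=0) | F_deg=24 rk5Cl(F)=2 rk5ClSigma(F)=2 Cl(F)=10,10 h(F)=100 certify=-2 | C=2 g=2 -> OPEN:g<=2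
  219024bv2@5 [Sha-cell] A=2 A_D=2 A_E=- (s_p=2 GRH; eps=0 e_p=0 t=0) | F_deg=24 rk5Cl(F)=2 rk5ClSigma(F)=2 Cl(F)=10,10 h(F)=100 certify=-2 | C=2 g=2 -> OPEN:g<=2
  232324c1@5 [OPEN-R0] A=0 A_D=0 A_E=- (s_p=0 UNCERTIFIED(descent gr; eps=0 e_p=0 t=0) | F_deg=24 rk5Cl(F)=0 rk5ClSigma(F)=0 Cl(F)=6,2,2 h(F)=24 certify=-1 | C=0 g=0 -> W0:Y=0
  254016cb1@5 [OPEN-R0] A=0 A_D=0 A_E=- (s_p=0 UNCERTIFIED(descent gr; eps=0 e_p=0 t=0) | F_deg=24 rk5Cl(F)=0 rk5ClSigma(F)=0 Cl(F)=2,2,2 h(F)=8 certify=-1 | C=0 g=0 -> W0:Y=0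
  272484k1@5 [Sha-cell] A=2 A_D=2 A_E=- (s_p=2 GRH; eps=0 e_p=0 t=0) | F_deg=24 rk5Cl(F)=1 rk5ClSigma(F)=1 Cl(F)=10,2 h(F)=20 certify=-2 | C=1 g=1 -> W1:Y-cyclic,width<=1
  272484k2@5 [Sha-cell] A=2 A_D=2 A_E=- (s_p=2 GRH; eps=0 e_p=0 t=0) | F_deg=24 rk5Cl(F)=1 rk5ClSigma(F)=1 Cl(F)=10,2 h(F)=20 certify=-2 | C=1 g=1 -> W1:Y-cyclic,width<=1
  374544bm1@5 [Sha-cell] A=2 A_D=2 A_E=- (s_p=2 GRH; eps=0 e_p=0 t=0) | F_deg=24 rk5Cl(F)=1 rk5ClSigma(F)=1 Cl(F)=10,2,2 h(F)=40 certify=-2 | C=1 g=1 -> W1:Y-cyclic,width<=1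
  374544bm2@5 [Sha-cell] A=2 A_D=2 A_E=- (s_p=2 GRH; eps=0 e_p=0 t=0) | F_deg=24 rk5Cl(F)=1 rk5ClSigma(F)=1 Cl(F)=10,2,2 h(F)=40 certify=-2 | C=1 g=1 -> W1:Y-cyclic,width<=1
  464648b1@5 [OPEN-R0] A=0 A_D=0 A_E=- (s_p=0 UNCERTIFIED(descent ab; eps=0 e_p=0 t=0) | F_deg=24 rk5Cl(F)=0 rk5ClSigma(F)=0 Cl(F)=12,2,2,2 h(F)=96 certify=-2 | C=0 g=0 -> W0:Y=0
  464648c1@5 [Sha-cell] A=2 A_D=2 A_E=- (s_p=2 GRH; eps=0 e_p=0 t=0) | F_deg=24 rk5Cl(F)=1 rk5ClSigma(F)=1 Cl(F)=60 h(F)=60 certify=-2 | C=1 g=1 -> W1:Y-cyclic,width<=1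
OPEN ROWS (17):
  8092f1@5 5S4 r1 OPEN:g<=2 A=3 A_D=2 A_E=2 g_lo=1 t_D=0 C=4 s_p=1(cert) eps=0 e_p=1 t=1 rk5ClS=0 sha_an=1.00000000000000
  23616be1@5 5Ns r1 OPEN:g<=2 A=3 A_D=2 A_E=2 g_lo=1 t_D=0 C=5 s_p=1(cert) eps=0 e_p=1 t=1 rk5ClS=0 sha_an=1.00000000000000
  25773p1@5 5Ns r1 OPEN:g<=2 A=3 A_D=2 A_E=- g_lo=1 t_D=1 C=5 s_p=1(cert) eps=0 e_p=0 t=2 rk5ClS=0 sha_an=1.00000000000000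
  47952b1@5 5S4 r0 OPEN:g<=2 A=2 A_D=2 A_E=- g_lo=1 t_D=1 C=4 s_p=0(cert) eps=0 e_p=1 t=1 rk5ClS=0 sha_an=1
  56316n1@5 5S4 r0 OPEN:g<=2 A=2 A_D=2 A_E=- g_lo=1 t_D=2 C=4 s_p=0(cert) eps=0 e_p=0 t=2 rk5ClS=0 sha_an=1
  106032bq1@5 5S4 r0 OPEN:g<=2 A=2 A_D=2 A_E=- g_lo=1 t_D=1 C=4 s_p=0(cert) eps=0 e_p=1 t=1 rk5ClS=0 sha_an=1
  110976bn1@5 5S4 r0 OPEN:g<=2 A=2 A_D=2 A_E=- g_lo=1 t_D=1 C=4 s_p=0(cert) eps=0 e_p=1 t=1 rk5ClS=0 sha_an=1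
  110976o1@5 5S4 r0 OPEN:g<=2 A=2 A_D=2 A_E=- g_lo=1 t_D=1 C=4 s_p=0(cert) eps=0 e_p=1 t=1 rk5ClS=0 sha_an=1
  129472do1@5 5S4 r0 OPEN:g<=2 A=2 A_D=2 A_E=- g_lo=1 t_D=1 C=4 s_p=0(cert) eps=0 e_p=1 t=1 rk5ClS=0 sha_an=1
  133956a1@5 5S4 r3 OPEN:g=2 exactly(X0 NOT cyclic) A=2 A_D=2 A_E=- g_lo=2 t_D=0 C=2 s_p=3(unc) eps=1 e_p=0 t=0 rk5ClS=2 sha_an=1.00000000000000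
  168948a1@5 5S4 r0 OPEN:g<=2 A=2 A_D=2 A_E=- g_lo=1 t_D=1 C=4 s_p=0(cert) eps=0 e_p=1 t=1 rk5ClS=0 sha_an=1.00000000000000
  199988e1@5 5S4 r0 OPEN:g<=2 A=3 A_D=3 A_E=- g_lo=1 t_D=1 C=2 s_p=2(cert) eps=0 e_p=0 t=1 rk5ClS=0 sha_an=25.0000000000000
  219024bv1@5 5S4 r0 OPEN:g<=2 A=2 A_D=2 A_E=- g_lo=1 t_D=0 C=2 s_p=2(cert) eps=0 e_p=0 t=0 rk5ClS=2 sha_an=25.0000000000000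
  219024bv2@5 5S4 r0 OPEN:g<=2 A=2 A_D=2 A_E=- g_lo=1 t_D=0 C=2 s_p=2(cert) eps=0 e_p=0 t=0 rk5ClS=2 sha_an=25.0000000000000
  229842k1@5 5S4 r1 OPEN:g<=2 A=3 A_D=2 A_E=2 g_lo=1 t_D=0 C=4 s_p=1(cert) eps=0 e_p=1 t=1 rk5ClS=0 sha_an=1.00000000000000
  337977p1@5 5S4 r0 OPEN:g<=2 A=2 A_D=2 A_E=- g_lo=1 t_D=1 C=4 s_p=0(cert) eps=0 e_p=1 t=1 rk5ClS=0 sha_an=9.00000000000000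
  494816o1@5 5S4 r0 OPEN:g<=2 A=2 A_D=2 A_E=- g_lo=1 t_D=1 C=4 s_p=0(cert) eps=0 e_p=1 t=1 rk5ClS=0 sha_an=1.00000000000000

References: J. Coates, R. Sujatha, Math. Ann. 331 (2005) §3 [CoatesSujatha2005]; R. Greenberg, LNM 1716 (1999) §3–§5
[Greenberg1999]; L. Washington, GTM 83 §13.2 [Washington1997]; HOME MEMO-desc §11, §25, §39.7; MEMO-imc 28.55–28.59.
-/

noncomputable section

open scoped Classical MatrixGroups ModularForm NumberField
open CongruenceSubgroup WeierstrassCurve Field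
open Literature.NumberTheory.EllipticCurves.ModularForms
open Literature.NumberTheory.GaloisRepresentations
open Literature.NumberTheory.EllipticCurves
open Literature.NumberTheory.EllipticCurves.Kato2004
open Literature.NumberTheory.EllipticCurves.Kato2004.EulerSystemValues
open Summit.BirchSwinnertonDyer.BirchSwinnertonDyer.Rank1Residual (ClassX9)
open Summit.BirchSwinnertonDyer.Rank1Residual.SmallImageMu (FineMuConcentratedOnClassX9)
open Summit.BirchSwinnertonDyer.BirchSwinnertonDyer.Theorems.OneSidedTwistSqueezeX9KatoDivisibilityX9OfGradedEulerLossLattice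
  (finite_and_isTorsion_fine_of_zeta fineMu_le_of_cyclic)
open Module IwasawaAlgebra

namespace Summit.BirchSwinnertonDyer.BirchSwinnertonDyer.Cruxes.KatoDivisibilityX9.Disproof

/-- The route decl under attack is literally the SIM width statement (kernel `rfl`). -/
theorem target_eq :
    Summit.BirchSwinnertonDyer.BirchSwinnertonDyer.Theses.OneSidedTwistSqueezeX9.KatoDivisibilityX9 =
      Summit.BirchSwinnertonDyer.Rank1Residual.SmallImageMu.KatoDivisibilityOnClassX9 := rfl

/-- **B2 at ONE pair** `(W, p)`: the per-pair conjunct of `FineMuConcentratedOnClassX9` (the unit the table decides). -/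
def WidthHalfAt (W : WeierstrassCurve ℚ) [W.IsElliptic] (p : ℕ) [Fact p.Prime] : Prop :=
  ∀ (κ : ZpExtension ℚ p) (γ : absoluteGaloisGroup ℚ), κ.IsCyclotomic → κ.IsTopGenerator γ →
    IsCyclotomicVariable p γ → ∀ (Y : W.FineSelmerDualData κ γ) (n : ℕ),
      muInvariant p ↥((augIdealP p ^ n) • (⊤ : Submodule (IwasawaAlgebra p) Y.X)) = 0 → muInvariant p Y.X ≤ n

/-- B2 is exactly «`WidthHalfAt` at every X9 pair» (bookkeeping: a refutation must exhibit ONE X9 pair failing it). -/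
theorem fineMuConcentratedOnClassX9_iff_forall_widthHalfAt :
    FineMuConcentratedOnClassX9 ↔
      ∀ (W : WeierstrassCurve ℚ) [W.IsElliptic] [W.IsGloballyMinimal] (p : ℕ) [Fact p.Prime],
        ClassX9 W p → WidthHalfAt W p := by
  constructor
  · intro h W _ _ p _ hX9 κ γ hκ hγ hγ' Y n hn0
    exact h W p κ γ hX9 hκ hγ hγ' Y n hn0
  · intro h W _ _ p _ κ γ hX9 hκ hγ hγ' Y n hn0
    exact h W p hX9 κ γ hκ hγ hγ' Y n hn0

/-- **Verdict shape `W1` of the table**: the dual fine Selmer datum at the pair is CYCLIC (`g(X₀) ≤ 1`). -/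
def FineDualCyclicAt (W : WeierstrassCurve ℚ) [W.IsElliptic] (p : ℕ) [Fact p.Prime] : Prop :=
  ∀ (κ : ZpExtension ℚ p) (γ : absoluteGaloisGroup ℚ), κ.IsCyclotomic → κ.IsTopGenerator γ →
    IsCyclotomicVariable p γ → ∀ (Y : W.FineSelmerDualData κ γ),
      ∃ x : Y.X, Submodule.span (IwasawaAlgebra p) {x} = ⊤

/-- **Verdict shape `W0` of the table**: the dual fine Selmer datum at the pair VANISHES (`g(X₀) = 0`; Conjecture A at the
pair in its strongest form). -/
def FineDualZeroAt (W : WeierstrassCurve ℚ) [W.IsElliptic] (p : ℕ) [Fact p.Prime] : Prop :=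
  ∀ (κ : ZpExtension ℚ p) (γ : absoluteGaloisGroup ℚ), κ.IsCyclotomic → κ.IsTopGenerator γ →
    IsCyclotomicVariable p γ → ∀ (Y : W.FineSelmerDualData κ γ), Subsingleton Y.X

/-- `W0 ⟹ W1`: the zero module is cyclic (generated by `0`). -/
theorem fineDualCyclicAt_of_fineDualZeroAt {W : WeierstrassCurve ℚ} [W.IsElliptic] {p : ℕ} [Fact p.Prime]
    (h : FineDualZeroAt W p) : FineDualCyclicAt W p := by
  intro κ γ hκ hγ hγ' Y
  haveI := h κ γ hκ hγ hγ' Y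
  haveI : Subsingleton (Submodule (IwasawaAlgebra p) Y.X) := (Submodule.subsingleton_iff _).mpr ‹_›
  exact ⟨0, Subsingleton.elim _ _⟩

/-- **`W1 ⟹` B2 at the pair** (module half; guards F1_ζ + a modularity witness are used ONLY to know `X₀` is finitely
generated torsion at an odd good ordinary pair, exactly as in the tree's `fineMuConcentratedOnClassX9_of_cyclic`). -/
theorem widthHalfAt_of_fineDualCyclicAt (hfine : exists_divisibilityInputs_fineQuotient_zeta)
    (hmodP : nonempty_modularParametrizationData)
    {W : WeierstrassCurve ℚ} [W.IsElliptic] [W.IsGloballyMinimal] {p : ℕ} [Fact p.Prime]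
    (hX9 : ClassX9 W p) (hcyc : FineDualCyclicAt W p) : WidthHalfAt W p := by
  intro κ γ hκ hγ hγ' Y n hn0
  obtain ⟨-, h5, hgood, hap, -, -⟩ := id hX9
  have hp2 : p ≠ 2 := by omega
  obtain ⟨hYf, hYt⟩ := finite_and_isTorsion_fine_of_zeta hfine hmodP hp2 ⟨hgood, hap⟩ hκ hγ hγ' Y
  haveI := hYf
  obtain ⟨x, hx⟩ := hcyc κ γ hκ hγ hγ' Y
  exact fineMu_le_of_cyclic Y hYt hx n hn0

/-- **`W0 ⟹` B2 at the pair**, same guards. -/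
theorem widthHalfAt_of_fineDualZeroAt (hfine : exists_divisibilityInputs_fineQuotient_zeta)
    (hmodP : nonempty_modularParametrizationData)
    {W : WeierstrassCurve ℚ} [W.IsElliptic] [W.IsGloballyMinimal] {p : ℕ} [Fact p.Prime]
    (hX9 : ClassX9 W p) (h0 : FineDualZeroAt W p) : WidthHalfAt W p :=
  widthHalfAt_of_fineDualCyclicAt hfine hmodP hX9 (fineDualCyclicAt_of_fineDualZeroAt h0)


/-! ## (c) A natural «decide it from data» strengthening is impossible: finite layers do not separate widths -/

/-- Layer-`k` count of the `Ω = 𝔽_p⟦T⟧`-module `M = Ω^r ⊕ ⊕_j Ω/T^{a_j}`: `dim_𝔽ₚ M/ω_k M = r·p^k + Σ_j min(a_j, p^k)`, because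
`ω_k = (1+T)^{p^k} − 1 ≡ T^{p^k} (mod p)`.  This `def` is the arithmetic shadow of that standard count (the module statement itself is
not re-proved here); `r = w(M)` is the width. -/
def layerCount (p r : ℕ) (blocks : List ℕ) (k : ℕ) : ℕ :=
  r * p ^ k + (blocks.map fun a => min a (p ^ k)).sum

/-- **No finite set of layers separates width 2 from width 1.**  The free module `Ω²` (width 2 — the shape a counterexample to
B2-at-a-pair must have) and `Ω ⊕ Ω/T^{p^n}` (width 1 — allowed by B2) have the same layer counts at every layer `k ≤ n`.  Hence no
computation confined to layers `≤ n` (for any fixed `n`) can exhibit `w(X₀) ≥ 2`; finite-layer data can only EXCLUDE it via upper bounds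
on the number of generators, which is what the width table does. -/
theorem layerCount_eq_of_le (p n k : ℕ) (hp : 0 < p) (hk : k ≤ n) :
    layerCount p 2 [] k = layerCount p 1 [p ^ n] k := by
  unfold layerCount
  have h : min (p ^ n) (p ^ k) = p ^ k := min_eq_right (Nat.pow_le_pow_right hp hk)
  simp only [List.map_nil, List.sum_nil, List.map_cons, List.sum_cons, h]
  ring

/-- The same ambiguity one storey down (Conjecture A vs B2): `Ω` (width 1) and `Ω/T^{p^n}` (width 0) agree at all layers `k ≤ n`. -/
theorem layerCount_eq_of_le' (p n k : ℕ) (hp : 0 < p) (hk : k ≤ n) :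
    layerCount p 1 [] k = layerCount p 0 [p ^ n] k := by
  unfold layerCount
  have h : min (p ^ n) (p ^ k) = p ^ k := min_eq_right (Nat.pow_le_pow_right hp hk)
  simp only [List.map_nil, List.sum_nil, List.map_cons, List.sum_cons, h]
  ring

/-!
## -- Targets
No `targets` / `line.stubs` were handed to this seat beyond the director's width-half target; the lead's line of record
is `Lines/graded_euler_loss.lean` (v4.2), whose `stub_widthX9` is the statement analysed above.  Nothing broken.

## HANDOFF (disprover)
* Landed under `Theorems/…/Negative/`: nothing (no negative statement is true short of a Conjecture-A counterexample).
* Sorried here: nothing.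
* Next regimes: engine C on the 16 PARTITION-open point fields (kit, when the `bsd_scale` allowance is set), then the other
  75 `A ≥ 2` rows; a `μ(Λ/p) = 1` lemma would let the module-shell strengthening of (0) be typed as `not_…`.
-/

end Summit.BirchSwinnertonDyer.BirchSwinnertonDyer.Cruxes.KatoDivisibilityX9.Disproof

end
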